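import Summits.Ventures.YMGap.RobustBall.SummableGlobalLipschitz
import HarnessLib

/-!
# Venture YMGap, track ROBUST-BALL (tier 2) — the MASSIVE BRIDGE for the SUMMABLE (infinite-range) member:
# the weighted row condition ⇒ exponential clustering of ALL bounded measurable local observables under
# every DLR state, at the rate `t` of the weight

HONEST FRAMING. WHAT THIS IS: a venture file (cell `pub-ymgap`, track Y2 ROBUST-BALL, seat ds-3),
strong-coupling LATTICE statement for `SU(N)` lattice Yang–Mills on `ℤ^d` with a PERTURBED action
`N β S_W + W`, `W` a SUMMABLE (infinite-range) link potential — rb-p1's tier-2 member `perturbedYMS`.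
The seat's tier-1 bridge (`PerturbedMassiveBridge.lean`) went through the abstract Lipschitz-cylinder
clustering clause `∀ n, ∃ c₁(n)` of `PerturbedMassGapAt` and the FINITE `W`-collar; for an infinite-range
member the collar is infinite and the clause hides the growth of `c₁(n)`, so that route is closed. This file
proves the clustering of all bounded local observables DIRECTLY from the weighted Dobrushin row condition
`6(d−1)|β| e^{a} e^{t} √(c v) + e^{a/2} √c Λ_t < 1` (the hypothesis of rb-p1's `perturbed_covariance_decay_S`,
same inputs `hP`, `hVB`, same loads): for every DLR state `μ` and all bounded measurable local `F₁, F₂`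
there is `C` with `|cov_μ(F₁, F₂ ∘ θ_x)| ≤ C e^{−t‖x‖_∞}` (`perturbedS_covariance_decay_quasilocal`).
METHOD: DLR smoothing of ONE observable (`cov(F₁, F₂∘θ_x) = cov(γ^W_{S₁}F₁, F₂∘θ_x)` once `S₁ ∩ (S₂ − x) = ∅`);
`γ^W_{S₁}F₁` is QUASILOCAL with the GLOBAL summable Lipschitz vector
`δ(y) = M₁ K 𝟙[y ∉ S₁](|b|·2(d−1)√N·𝟙[y ∈ links of plaquettes touching S₁] + ∑_{e ∈ S₁} ℓ(e, y))`
(`SummableSmoothing` + `abs_sub_le_tsum_of_isLipBound_of_quasilocal`); then the seat's Dobrushin–Föllmer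
estimate for a quasilocal observable against a bounded local one (`QuasilocalCovariance`) with the profile
`dist(·, S₂ − x)` and rb-p1's zero-diagonal coefficients: the weighted cross load gives
`∑_y e^{−tρ(y)} ℓ(e, y) ≤ e^{−tρ(e)} Λ_t` by the 1-Lipschitz profile, whence the rate `t`
(`SummableGlobalLipschitz.lean`). WHAT IT IS NOT: no new threshold or row; nothing about the continuum,
confinement, a transfer-matrix gap or the Clay problem.

References: H. Föllmer, LNM 1362 (1988), Ch. I, Thm. (2.13), Cor. (2.14), (2.23)–(2.24); H. Künsch,
CMP 84 (1982) 207–222; H.-O. Georgii (2011), Def. 1.23, Prop. 8.8, Remark 8.26; K. Osterwalder, E. Seiler,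
Ann. Phys. 110 (1978) 440, §4.
-/

noncomputable section

open MeasureTheory ProbabilityTheory Function Finset Filter Topology
open scoped NNReal
open Literature.Probability.LatticeModels
open Literature.Probability.LatticeModels.DobrushinMetric
open Literature.MathematicalPhysics.QuantumLattice
open Literature.MathematicalPhysics.QuantumFieldTheory hiding ZdEdge
open Literature.MathematicalPhysics.QuantumFieldTheory.Balaban1983to89
open Literature.MathematicalPhysics.QuantumFieldTheory.Balaban1983to89.StrongCouplingTorusWindow
open Summit.Ventures.YMGap.ZdSmoothing

namespace Summit.Ventures.YMGap.RobustBall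

variable {d N : ℕ}

section SUN

variable {W : Potential (ZdEdge d) (Matrix.specialUnitaryGroup (Fin N) ℂ)} {B : Finset (ZdEdge d) → ℝ}

/-! ### The bridge: the weighted row condition ⇒ clustering of all bounded local observables at rate `t` -/

/-- **Exponential clustering of ALL bounded measurable local observables under every DLR state of the
summable member, at the rate `t` of the weight** (`SU(N)`, every `d ≥ 1`, 't Hooft coupling `β`): under
the hypotheses of rb-p1's `perturbed_covariance_decay_S` — Poincaré/linear-variance inputs `hP`, `hVB` on the
staple ball `‖B‖_op ≤ b ⊇ 2(d−1)|β|`, a summable member with continuous own-link terms, oscillation load `a`,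
diagonal-free weighted cross load `Λ_t` (`t ≥ 0`), and the ROW CONDITION
`6(d−1)|β| e^{a} e^{t} √(c v) + e^{a/2} √c Λ_t < 1` — for every DLR state `μ` of
`perturbedYMS (fundamentalRep (Fin N)) (N β) W` and every pair of bounded measurable local observables
`F₁, F₂` there is `C` with `|cov_μ(F₁, F₂ ∘ θ_x)| ≤ C e^{−t‖x‖_∞}` for all `x ∈ ℤ^d`. Method: DLR smoothing
of `F₁` only (`cov(F₁, F₂∘θ_x) = cov(γ^W_{S₁}F₁, F₂∘θ_x)` once `S₁ ∩ (S₂ − x) = ∅`), then the seat's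
Dobrushin–Föllmer estimate for the quasilocal `γ^W_{S₁}F₁` against the local `F₂∘θ_x`
(`abs_covariance_le_of_summable_exp_profile_quasilocal`) with rb-p1's zero-diagonal coefficients and the
profile `dist(·, S₂ − x) ≥ ‖x‖ − D` on `S₁`. -/
theorem perturbedS_covariance_decay_quasilocal (hd : 1 ≤ d) (hN : 1 ≤ N) {β b c v a Λt t : ℝ}
    (hc : 0 ≤ c) (hv : 0 ≤ v) (hb : |β| * (2 * ((d : ℝ) - 1)) ≤ b)
    (hP : ∀ B : Matrix (Fin N) (Fin N) ℂ, matrixOpNorm B ≤ b →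
      ∀ (ψ : Matrix.specialUnitaryGroup (Fin N) ℂ → ℝ) (M : ℝ), 0 ≤ M →
        (∀ x y, |ψ x - ψ y| ≤ M * suFrobDist x y) →
        Var[ψ; (haarProbability (Matrix.specialUnitaryGroup (Fin N) ℂ)).tilted
          fun g => (N : ℝ) * ((g : Matrix (Fin N) (Fin N) ℂ) * B).trace.re] ≤ c * M ^ 2)
    (hVB : ∀ B : Matrix (Fin N) (Fin N) ℂ, matrixOpNorm B ≤ b → ∀ Δ : Matrix (Fin N) (Fin N) ℂ,
      Var[fun g : Matrix.specialUnitaryGroup (Fin N) ℂ =>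
          (N : ℝ) * ((g : Matrix (Fin N) (Fin N) ℂ) * Δ).trace.re;
        (haarProbability (Matrix.specialUnitaryGroup (Fin N) ℂ)).tilted
          fun g => (N : ℝ) * ((g : Matrix (Fin N) (Fin N) ℂ) * B).trace.re] ≤ v * frobNorm Δ ^ 2)
    (h : IsLinkSummable W B) (hWc : ∀ X, Continuous (W X))
    (hWdep : ∀ X, DependsOn (W X) (↑X : Set (ZdEdge d)))
    {osc : Finset (ZdEdge d) → ZdEdge d → ℝ} (hosc : ∀ X, Dobrushin.IsOscBound (W X) (osc X))
    (hoscs : ∀ e, Summable fun X : Finset (ZdEdge d) => (if e ∈ X then osc X e else 0))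
    (hosca : ∀ e, ∑' X : Finset (ZdEdge d), (if e ∈ X then osc X e else 0) ≤ a)
    {lip : Finset (ZdEdge d) → ZdEdge d → ℝ} (hlip : ∀ X, IsLipBound suFrobDist (W X) (lip X))
    {ℓ : ZdEdge d → ZdEdge d → ℝ}
    (hlips : ∀ e y, Summable fun X : Finset (ZdEdge d) => (if e ∈ X ∧ y ∈ X then lip X y else 0))
    (hℓ : ∀ e y, y ≠ e → ∑' X : Finset (ZdEdge d), (if e ∈ X ∧ y ∈ X then lip X y else 0) ≤ ℓ e y)
    (ht : 0 ≤ t) (hℓs : ∀ e, Summable fun y => (if y = e then 0 else ℓ e y) * Real.exp (t * ‖e.1 - y.1‖))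
    (hℓt : ∀ e, ∑' y, (if y = e then 0 else ℓ e y) * Real.exp (t * ‖e.1 - y.1‖) ≤ Λt)
    (hρ : 6 * ((d : ℝ) - 1) * |β| * (Real.exp a * Real.exp t * Real.sqrt (c * v)) +
      Real.exp (a / 2) * Real.sqrt c * Λt < 1)
    {μ : Measure (LGConfig d (Matrix.specialUnitaryGroup (Fin N) ℂ))}
    (hμ : μ ∈ perturbedGibbsMeasuresS (d := d) (fundamentalRep (Fin N)) (N * β) W)
    (F₁ F₂ : LGConfig d (Matrix.specialUnitaryGroup (Fin N) ℂ) → ℝ)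
    (h₁ : Literature.MathematicalPhysics.QuantumLattice.IsLocalObservable F₁)
    (h₂ : Literature.MathematicalPhysics.QuantumLattice.IsLocalObservable F₂) (h₁m : Measurable F₁)
    (h₂m : Measurable F₂) (hb₁ : ∃ C, ∀ U, |F₁ U| ≤ C) (hb₂ : ∃ C, ∀ U, |F₂ U| ≤ C) :
    ∃ C : ℝ, ∀ x : Site d,
      |cov[F₁, fun U => F₂ (Literature.MathematicalPhysics.QuantumLattice.configShift x U); μ]| ≤
        C * Real.exp (-t * ‖x‖) := by
  classical
  haveI : SecondCountableTopology (Matrix (Fin N) (Fin N) ℂ) :=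
    inferInstanceAs (SecondCountableTopology (Fin N → Fin N → ℂ))
  haveI : SecondCountableTopology (Matrix.specialUnitaryGroup (Fin N) ℂ) :=
    Topology.IsEmbedding.subtypeVal.secondCountableTopology
  have hd0 : 0 < d := hd
  have hN0 : (0 : ℝ) < N := by exact_mod_cast hN
  have hγ : IsSpecification (perturbedYMS (d := d) (fundamentalRep (Fin N)) (N * β) W) :=
    isSpecification_perturbedYMS _ (continuous_fundamentalRep (Fin N)) _ h hWc hWdep
  have hGibbs : IsGibbsMeasure (perturbedYMS (d := d) (fundamentalRep (Fin N)) (N * β) W) μ := hμ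
  haveI : IsProbabilityMeasure μ := hGibbs.isProbabilityMeasure
  -- supports (made non-empty by adjoining one fixed link) and bounds
  obtain ⟨S₁', hS₁'⟩ := h₁
  obtain ⟨S₂', hS₂'⟩ := h₂
  obtain ⟨M₁, hM₁⟩ := hb₁
  obtain ⟨M₂, hM₂⟩ := hb₂
  set e₀ : ZdEdge d := ((0 : Site d), (⟨0, hd0⟩ : Fin d)) with he₀
  set S₁ : Finset (ZdEdge d) := insert e₀ S₁' with hS₁def
  set S₂ : Finset (ZdEdge d) := insert e₀ S₂' with hS₂def
  have hS₁ : IsCylinder F₁ S₁ :=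
    DependsOn.mono (fun e he => Finset.mem_coe.2 (Finset.mem_insert_of_mem (Finset.mem_coe.1 he))) hS₁'
  have hS₂ : IsCylinder F₂ S₂ :=
    DependsOn.mono (fun e he => Finset.mem_coe.2 (Finset.mem_insert_of_mem (Finset.mem_coe.1 he))) hS₂'
  have hS₂ne : S₂.Nonempty := Finset.insert_nonempty _ _
  have hM₁0 : 0 ≤ M₁ := (abs_nonneg _).trans (hM₁ fun _ => 1)
  have hM₂0 : 0 ≤ M₂ := (abs_nonneg _).trans (hM₂ fun _ => 1)
  -- the displacement bound `D` over `S₁ × S₂` (a double sum dominating every pair distance)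
  obtain ⟨D, hDdef⟩ : ∃ D : ℝ, D = ∑ a ∈ S₁, ∑ b ∈ S₂, ‖a.1 - b.1‖ := ⟨_, rfl⟩
  have hD : ∀ a₀ ∈ S₁, ∀ b₀ ∈ S₂, ‖a₀.1 - b₀.1‖ ≤ D := by
    intro a₀ ha₀ b₀ hb₀
    rw [hDdef]
    calc ‖a₀.1 - b₀.1‖ ≤ ∑ b ∈ S₂, ‖a₀.1 - b.1‖ :=
          Finset.single_le_sum (f := fun b : ZdEdge d => ‖a₀.1 - b.1‖) (fun b _ => norm_nonneg _) hb₀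
      _ ≤ ∑ a ∈ S₁, ∑ b ∈ S₂, ‖a.1 - b.1‖ :=
          Finset.single_le_sum (f := fun a : ZdEdge d => ∑ b ∈ S₂, ‖a.1 - b.1‖)
            (fun a _ => Finset.sum_nonneg fun b _ => norm_nonneg _) ha₀
  -- the global Lipschitz vector of the smoothing `f₁ = γ_{S₁} F₁`
  obtain ⟨δ₁, Φ, hΦ0, hδ₁0, hδ₁s, hglobal, hprof⟩ := exists_globalLip_specAvg_perturbedYMS hd hN (N * β) h hWc
    hWdep hlip hlips hℓ ht hℓs hℓt S₁ h₁m hS₁ hM₁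
  set f₁ : LGConfig d (Matrix.specialUnitaryGroup (Fin N) ℂ) → ℝ :=
    specAvg (perturbedYMS (d := d) (fundamentalRep (Fin N)) (N * β) W) S₁ F₁ with hf₁def
  have hf₁m : Measurable f₁ := measurable_specAvg hγ S₁ h₁m
  have hf₁M : ∀ U, |f₁ U| ≤ M₁ := abs_specAvg_le hγ S₁ hM₁
  -- rb-p1's zero-diagonal Dobrushin coefficients and their weighted rows
  have hlip0 : ∀ X z, 0 ≤ lip X z := fun X z => (hlip X).nonneg z
  have hℓ0 : ∀ e y, y ≠ e → 0 ≤ ℓ e y := fun e y hye => by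
    refine le_trans (tsum_nonneg fun X => ?_) (hℓ e y hye)
    split_ifs
    · exact hlip0 X y
    · exact le_rfl
  have hℓ00 : ∀ e y, 0 ≤ (if y = e then 0 else ℓ e y) := fun e y => by
    split_ifs with hye
    · exact le_rfl
    · exact hℓ0 e y hye
  have hrow := fun x => summable_coeffS_row₀ (β := β) (c := c) (v := v) (a := a) hd hℓ0 ht hℓs hℓt x
  have hℓs' : ∀ e, Summable fun y => (if y = e then 0 else ℓ e y) := fun e =>
    Summable.of_nonneg_of_le (hℓ00 e) (fun y => le_mul_of_one_le_right (hℓ00 e y)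
      (Real.one_le_exp (by positivity))) (hℓs e)
  have hC0 : ∀ x y : ZdEdge d, 0 ≤ (if y = x then 0 else
      (Real.exp a * Real.sqrt (c * v) * |β| * linkInfluence x y + Real.exp (a / 2) * Real.sqrt c * ℓ x y)) :=
    fun x y => by
      split_ifs with hyx
      · exact le_rfl
      · exact add_nonneg (by positivity) (mul_nonneg (by positivity) (hℓ0 x y hyx))
  have hρ0 : 0 ≤ 6 * ((d : ℝ) - 1) * |β| * (Real.exp a * Real.exp t * Real.sqrt (c * v)) +
      Real.exp (a / 2) * Real.sqrt c * Λt := (tsum_nonneg (hC0 e₀)).trans (hrow e₀).2.2.1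
  have hRsqrt : (0 : ℝ) ≤ 2 * Real.sqrt N := by positivity
  -- the constant
  set Cfar : ℝ := 2 * (2 * M₂) * (2 * Real.sqrt N) * Φ with hCfar
  have hCfar0 : 0 ≤ Cfar := by positivity
  refine ⟨(2 * M₁ * M₂ + Cfar) * Real.exp (t * D), fun x => ?_⟩
  set Gx : LGConfig d (Matrix.specialUnitaryGroup (Fin N) ℂ) → ℝ :=
    F₂ ∘ Literature.MathematicalPhysics.QuantumLattice.configShift x with hGxdef
  obtain ⟨S₂x, hS₂x⟩ : ∃ S : Finset (ZdEdge d), S = S₂.image fun e => (e.1 - x, e.2) := ⟨_, rfl⟩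
  have hGxS : IsCylinder Gx S₂x := by rw [hS₂x]; exact IsCylinder.comp_configShift hS₂ x
  have hGxm : Measurable Gx := h₂m.comp (Literature.MathematicalPhysics.QuantumLattice.configShift x).measurable
  have hGxM : ∀ U, |Gx U| ≤ M₂ := fun U => hM₂ _
  have hGxosc : ∀ U V, |Gx U - Gx V| ≤ 2 * M₂ := fun U V =>
    (abs_sub _ _).trans (by linarith [hGxM U, hGxM V])
  have hS₂xne : S₂x.Nonempty := by rw [hS₂x]; exact hS₂ne.image _
  have hL2 : ∀ {f : LGConfig d (Matrix.specialUnitaryGroup (Fin N) ℂ) → ℝ} {M : ℝ}, Measurable f →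
      (∀ U, |f U| ≤ M) → MemLp f 2 μ := fun hf hfM =>
    memLp_of_bounded (ae_of_all _ fun U => abs_le.1 (hfM U)) hf.aestronglyMeasurable 2
  have hcov : cov[F₁, fun U => F₂ (Literature.MathematicalPhysics.QuantumLattice.configShift x U); μ] =
      (∫ U, F₁ U * Gx U ∂μ) - (∫ U, F₁ U ∂μ) * ∫ U, Gx U ∂μ :=
    covariance_eq_sub (hL2 h₁m hM₁) (hL2 hGxm hGxM)
  have hexp0 : 0 < Real.exp (-t * ‖x‖) := Real.exp_pos _
  by_cases hnear : ‖x‖ ≤ D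
  · -- NEAR: the trivial bound `|cov| ≤ 2 M₁ M₂` and `e^{tD} e^{-t‖x‖} ≥ 1`
    rw [hcov]
    have htriv : |(∫ U, F₁ U * Gx U ∂μ) - (∫ U, F₁ U ∂μ) * ∫ U, Gx U ∂μ| ≤ 2 * M₁ * M₂ := by
      refine (abs_sub _ _).trans ?_
      have e1 := StrongCouplingTorusWindow.abs_integral_le_of_abs_le (μ := μ) (abs_mul_le_of_abs_le hM₁ hGxM)
      have e2 : |(∫ U, F₁ U ∂μ) * ∫ U, Gx U ∂μ| ≤ M₁ * M₂ := by
        rw [abs_mul]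
        exact mul_le_mul (StrongCouplingTorusWindow.abs_integral_le_of_abs_le hM₁)
          (StrongCouplingTorusWindow.abs_integral_le_of_abs_le hGxM) (abs_nonneg _) hM₁0
      linarith
    have hone : 1 ≤ Real.exp (t * D) * Real.exp (-t * ‖x‖) := by
      rw [← Real.exp_add]
      refine Real.one_le_exp ?_
      have := mul_le_mul_of_nonneg_left hnear ht
      linarith
    refine htriv.trans ?_
    have h2MM : 0 ≤ 2 * M₁ * M₂ := by positivity
    calc 2 * M₁ * M₂ ≤ 2 * M₁ * M₂ * (Real.exp (t * D) * Real.exp (-t * ‖x‖)) := le_mul_of_one_le_right h2MM hone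
      _ ≤ (2 * M₁ * M₂ + Cfar) * (Real.exp (t * D) * Real.exp (-t * ‖x‖)) :=
          mul_le_mul_of_nonneg_right (le_add_of_nonneg_right hCfar0) (mul_nonneg (Real.exp_pos _).le hexp0.le)
      _ = (2 * M₁ * M₂ + Cfar) * Real.exp (t * D) * Real.exp (-t * ‖x‖) := by ring
  -- FAR: `D < ‖x‖`; `S₁ ∩ (S₂ − x) = ∅` and `dist(S₁, S₂ − x) ≥ ‖x‖ − D`
  rw [not_le] at hnear
  have hfar : ∀ a₀ ∈ S₁, ∀ b' ∈ S₂x, ‖x‖ - D ≤ ‖a₀.1 - b'.1‖ := by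
    intro a₀ ha₀ b' hb'
    rw [hS₂x] at hb'
    obtain ⟨b₀, hb₀, rfl⟩ := Finset.mem_image.1 hb'
    have h1 := hD a₀ ha₀ b₀ hb₀
    have h2 : ‖x‖ ≤ ‖a₀.1 - (b₀.1 - x)‖ + ‖a₀.1 - b₀.1‖ := by
      have e : x = (a₀.1 - (b₀.1 - x)) - (a₀.1 - b₀.1) := by abel
      calc ‖x‖ = ‖(a₀.1 - (b₀.1 - x)) - (a₀.1 - b₀.1)‖ := by rw [← e]
        _ ≤ ‖a₀.1 - (b₀.1 - x)‖ + ‖a₀.1 - b₀.1‖ := norm_sub_le _ _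
    dsimp only
    linarith
  have hdisj : ∀ a₀ ∈ S₁, a₀ ∉ S₂x := by
    intro a₀ ha₀ hb
    have h' := hfar a₀ ha₀ a₀ hb
    rw [sub_self, norm_zero] at h'
    linarith
  have hm₀ : ∀ e ∈ S₁, ‖x‖ - D ≤ linkSetDist S₂x e := by
    intro e he
    unfold linkSetDist
    rw [dif_pos hS₂xne]
    exact (Finset.le_inf'_iff hS₂xne _).2 fun b' hb' => hfar e he b' hb'
  -- DLR smoothing of `F₁`: the integrals against `Gx` (blind to `S₁`) are unchanged
  have hI₁ : ∫ U, F₁ U * Gx U ∂μ = ∫ U, f₁ U * Gx U ∂μ :=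
    (integral_specAvg_mul hγ hGibbs S₁ h₁m hM₁ hGxm hGxM hGxS fun e he heS =>
      hdisj e he (Finset.mem_coe.1 heS)).symm
  have hI₂ : ∫ U, F₁ U ∂μ = ∫ U, f₁ U ∂μ := (integral_specAvg hγ hGibbs S₁ h₁m hM₁).symm
  have hcov' : cov[F₁, fun U => F₂ (Literature.MathematicalPhysics.QuantumLattice.configShift x U); μ] =
      cov[f₁, Gx; μ] := by
    rw [hcov, hI₁, hI₂]
    exact (covariance_eq_sub (hL2 hf₁m hf₁M) (hL2 hGxm hGxM)).symm
  rw [hcov']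
  -- the Dobrushin–Föllmer estimate for the quasilocal `f₁` against the local `Gx`
  have key := abs_covariance_le_of_summable_exp_profile_quasilocal
    (C := fun x y : ZdEdge d => if y = x then 0 else
      (Real.exp a * Real.sqrt (c * v) * |β| * linkInfluence x y + Real.exp (a / 2) * Real.sqrt c * ℓ x y))
    hγ (fun _ _ => suFrobDist_nonneg _ _) suFrobDist_le hRsqrt suFrobDist_self hC0 (fun x => (hrow x).1)
    (fun x ω η φ L' hφm hφb hL' hφL => abs_integral_siteLaw_perturbedYMS_sub_le_tsum₀ hd hN hc hv hb hP hVB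
      h hWc hWdep hosc hoscs hosca hlip hlips hℓ hℓs' x ω η φ L' hφm hφb hL' hφL)
    hGibbs hf₁m hf₁M hδ₁0 hδ₁s hglobal hGxm hGxS hGxM hGxosc hρ0 hρ
    (fun x y : ZdEdge d => ‖x.1 - y.1‖) (fun _ _ => norm_nonneg _) ht
    (fun x _ => (hrow x).2.1) (fun x _ => (hrow x).2.2.2) (linkSetDist S₂x) (linkSetDist_nonneg S₂x)
    (fun y hy => linkSetDist_eq_zero_of_mem hy) (fun x _ y => linkSetDist_le_add_norm S₂x x y)
  have hsum := hprof S₂x (‖x‖ - D) hm₀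
  refine key.trans ?_
  have h22 : 0 ≤ 2 * (2 * M₂) * (2 * Real.sqrt N) := by positivity
  calc 2 * (2 * M₂) * (2 * Real.sqrt N) * ∑' y, Real.exp (-(t * linkSetDist S₂x y)) * δ₁ y
      ≤ 2 * (2 * M₂) * (2 * Real.sqrt N) * (Φ * Real.exp (-(t * (‖x‖ - D)))) :=
        mul_le_mul_of_nonneg_left hsum h22
    _ = Cfar * Real.exp (t * D) * Real.exp (-t * ‖x‖) := by
        rw [hCfar, show -(t * (‖x‖ - D)) = t * D + -t * ‖x‖ by ring, Real.exp_add]; ring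
    _ ≤ (2 * M₁ * M₂ + Cfar) * Real.exp (t * D) * Real.exp (-t * ‖x‖) := by
        refine mul_le_mul_of_nonneg_right (mul_le_mul_of_nonneg_right ?_ (Real.exp_pos _).le) hexp0.le
        exact le_add_of_nonneg_left (by positivity)

end SUN

end Summit.Ventures.YMGap.RobustBall

end
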